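import Literature.Computability.Complexity.CircuitLowerBounds
import Literature.Computability.Complexity.SuccinctSkeletonReductions
import Literature.Computability.Complexity.UniversalWitnessCircuitsHardInputs
import Literature.Computability.Complexity.EasyWitnessUniversalProofs
import Literature.Computability.Complexity.Williams2014Lemma31
import Literature.Computability.Complexity.Williams2014PreprocFinal
import Literature.Computability.Complexity.DiagMachine
import Literature.Computability.Complexity.Williams2014LowerBoundProofs
import Literature.Computability.Complexity.IKWGeneratorsProofs
import Literature.Computability.Complexity.Williams2014Proofs
import HarnessLib

/-!
# `williams_acc` (Williams 2014, Thm. 1.1): the assembled proof tree and its current leaves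

Sibling of `CircuitLowerBounds.lean` for the named fact `williams_acc : ¬ (NTIME (2 ^ ·) ⊆ ACC0)`
(R. Williams, *Nonuniform ACC circuit lower bounds*, J. ACM 61 (2014), Thm. 1.1). The printed
proof (Thm. 1.1 from Thm. 1.3 and Thm. 4.1, p. 17–18; Thm. 1.3 from Fact 3.1, Lemma 3.1,
Thm. 3.2, Lemma 5.1, Thm. 5.1–5.2 and the nondeterministic time hierarchy theorem) has been
opened in the tree layer by layer; this file JOINS the proved assembly theorems of those layers
into one statement over the facts that are still open, so that the discharge
`williams_acc_holds` is a one-line application once they are theorems: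

* the nondeterministic time hierarchy theorem is the tree's theorem `Diag.ntime_hierarchy_holds`
  (`DiagMachine.lean`; Arora–Barak 2009, Thm. 3.2), one of the five components of
  `williams_acc_of_ikw_components`;
* `williams_acc_of_frontier` — **proved**: `williams_acc` follows from
  (1) Fact 3.1 in skeleton form (`Williams2014_fact_3_1_skeleton`, the quasi-linear succinct
  Cook–Levin reduction; `Williams2014_fact_3_1_of_skeleton`, `SuccinctSkeletonReductions.lean`),
  (2) `EXP ⊆ P/poly ⟹ EXP = MA` (`EXP_eq_MA_of_subset_PPoly`, Babai–Fortnow–Nisan–Wigderson;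
  IKW 2002, Thm. 22) and (3) the derandomization of `MA` from a verifier without witness
  circuits (`Williams2010_MA_io_of_not_witnessCircuits`, Williams 2010, App. A), which with the
  tree's theorems `IKW2002_lemma5_holds`, `IKW2002_thm2_holds` give Thm. 5.2
  (`Williams2014_thm_5_2_of_leaves`, `UniversalWitnessCircuitsHardInputs.lean`),
  (4) Lemma 3.1 (`Williams2014_lemma_3_1`, the generator `A`) and (5) the machine `B` of the
  proof of Thm. 3.2 (`Williams2014_thm_3_2_machineB`), which give Thm. 3.2
  (`Williams2014_thm_3_2_of_parts`, `Williams2014Lemma31.lean`), and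
  (6) the algorithmic `ACC ⊆ SYM⁺` conversion (`Williams2014_lemma_4_1`, Lemma 4.1 / App. A),
  which with the tree's evaluation algorithm (`Williams2014_lemma_4_2_holds`, Yates) gives the
  `ACC`-SAT algorithm of Thm. 4.1 in polynomial-size form
  (`Williams2014_accSat_polysize_of_lemma_4_1`, `Williams2014PreprocFinal.lean`);
  the five are combined by `williams_acc_of_ikw_components` (`SuccinctWitnessesFromUWC.lean`:
  Thm. 5.1 from Thm. 5.2, the transfer theorem Thm. 1.3, and Thm. 1.1 from Thm. 1.3 + Thm. 4.1).

* `williams_acc_holds` — **proved**: the discharge of the named fact `williams_acc`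
  (`CircuitLowerBounds.lean`). By now every leaf is a theorem of the tree: IKW's Thm. 12 (2)
  (`IKW2002_thm12_2_holds`, `IKWGeneratorsProofs.lean`), from which Williams 2010, App. A and
  hence Thm. 5.2, Thm. 5.1 and the transfer theorem Thm. 1.3 for `ACC` follow
  (`Williams2014_lowerBound_of_accSat_of_thm12_2`, `Williams2014LowerBoundProofs.lean`, over
  `Williams2014_fact_3_1_holds`, `Williams2014_lemma_3_1_holds`, `Williams2014_thm_3_2_holds`,
  `EXP_eq_MA_of_subset_PPoly_holds`, `IKW2002_lemma5_holds`, `IKW2002_thm2_holds`,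
  `Diag.ntime_hierarchy_holds`), and the algorithmic `ACC ⊆ SYM⁺` conversion of Lemma 4.1
  (`Williams2014_lemma_4_1_holds`, `Williams2014Proofs.lean`), which gives the `ACC`-SAT
  algorithm of Thm. 4.1; Thm. 1.1 = Thm. 1.3 + Thm. 4.1 is `williams_acc_of_thm12_2_of_lemma_4_1`
  (`Williams2014LowerBoundProofs.lean`).

No new named fact is introduced; the six hypotheses of `williams_acc_of_frontier` are existing
named facts of the tree, each with its own locator, and this file only records the proved
implications between them and `williams_acc`, and the final discharge.

## References

* R. Williams, *Nonuniform ACC circuit lower bounds*, J. ACM 61(1) (2014) 2:1–2:32, Thm. 1.1 and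
  its proof (p. 17–18), Thm. 1.3, Fact 3.1, Lemma 3.1, Thm. 3.2, Thm. 4.1, Lemmas 4.1–4.2,
  Lemma 5.1, Thm. 5.1–5.2 [Williams2014].
* R. Impagliazzo, V. Kabanets, A. Wigderson, *In search of an easy witness: exponential time vs.
  probabilistic polynomial time*, JCSS 65 (2002) 672–694, Lemma 5, Thm. 2, Thm. 22
  [ImpagliazzoKabanetsWigderson2002].
* S. Arora, B. Barak, *Computational Complexity: A Modern Approach*, CUP 2009, Thm. 3.2
  [AroraBarak2009].
-/

namespace Literature.Computability.Complexity

/-- **Williams' Theorem 1.1 from the current leaves of its proof tree.** `NTIME(2ⁿ) ⊄ ACC⁰`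
(`williams_acc`) follows from: Fact 3.1 in skeleton form (quasi-linear succinct Cook–Levin,
`Williams2014_fact_3_1_skeleton`); `EXP ⊆ P/poly ⟹ EXP = MA` (`EXP_eq_MA_of_subset_PPoly`);
the derandomization of `MA` from a verifier without small witness circuits
(`Williams2010_MA_io_of_not_witnessCircuits`); Lemma 3.1 (`Williams2014_lemma_3_1`); the
machine `B` of the proof of Thm. 3.2 (`Williams2014_thm_3_2_machineB`); and the algorithmic
`ACC ⊆ SYM⁺` conversion of Lemma 4.1 (`Williams2014_lemma_4_1`). Everything else in the
printed proof — Thm. 5.1 from Thm. 5.2, IKW's Lemma 5 and Thm. 2, Lemma 5.1, the random-access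
simulation behind Fact 3.1, Thm. 3.2 from its two halves, Lemma 4.2 and the assembly of
Thm. 4.1, the transfer theorem Thm. 1.3, the nondeterministic time hierarchy theorem and
Thm. 1.1 from Thm. 1.3 + Thm. 4.1 — is proved in the tree and invoked here.
[cite: Williams2014, Thm. 1.1 and its proof (p. 17–18)] -/
theorem williams_acc_of_frontier (h31 : Williams2014_fact_3_1_skeleton)
    (h22 : EXP_eq_MA_of_subset_PPoly) (hA : Williams2010_MA_io_of_not_witnessCircuits)
    (hL : Williams2014_lemma_3_1) (hB : Williams2014_thm_3_2_machineB)
    (h41 : Williams2014_lemma_4_1) : williams_acc :=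
  williams_acc_of_ikw_components (Williams2014_fact_3_1_of_skeleton h31)
    (Williams2014_thm_5_2_of_leaves h22 hA IKW2002_lemma5_holds)
    (Williams2014_thm_3_2_of_parts hL hB) Diag.ntime_hierarchy_holds
    (Williams2014_accSat_polysize_of_lemma_4_1 h41)

/-- **Williams' Theorem 1.1, discharged: `NTIME(2ⁿ) ⊄ ACC⁰`** (the named fact `williams_acc`,
`CircuitLowerBounds.lean`). The printed proof (p. 17–18): assume `NTIME(2ⁿ) ⊆ ACC⁰`; by the
transfer theorem Thm. 1.3 for `ACC` (from Fact 3.1, Lemma 3.1, Thm. 3.2, Lemma 5.1, Thm. 5.1–5.2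
with IKW's easy-witness results, and the nondeterministic time hierarchy theorem — the tree's
`Williams2014_lowerBound_of_accSat_of_thm12_2` on the theorem `IKW2002_thm12_2_holds`) it suffices
to decide `ACC` CIRCUIT SAT on `n + c log n` inputs and polynomial size in `O(2ⁿ/nᶜ)` time for every
`c`, which is Thm. 4.1 (from the `ACC → SYM⁺` conversion of Lemma 4.1, the theorem
`Williams2014_lemma_4_1_holds`, and the evaluation Lemma 4.2); the assembly of Thm. 1.1 from these
two leaves is `williams_acc_of_thm12_2_of_lemma_4_1`.
[cite: Williams2014, Thm. 1.1 and its proof (p. 17–18)] -/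
theorem williams_acc_holds : williams_acc :=
  williams_acc_of_thm12_2_of_lemma_4_1 IKW2002_thm12_2_holds Williams2014_lemma_4_1_holds

end Literature.Computability.Complexity
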